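import Summits.Ventures.AbcShadow.SH01.BVY04Package
import Summits.Ventures.AbcSig.Sieve.CertificateModN

/-!
# Venture AbcShadow — the [BD10] PRINT INPUTS for `x⁵ + y⁵ = 13 z^p` as NAMED HYPOTHESES, and the Frey-trace sets `A_q`

HONEST FRAMING. Interface file of the work-bound cell `abc-shadow` (typer seat `abc-shadow-typ-1`, lineage g2). NOTHING in
this file is a theorem about a Diophantine equation; nothing here is a claim on abc or on any summit; no side on IUT is taken.
It TYPES, as a named `Prop` that the row theorem `SH04/RowBD13_11.lean` takes as an explicit hypothesis (named-fact
discipline, D-0014; never an `axiom`, never an `instance`), the published inputs of the modular method for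
`x⁵ + y⁵ = d z^p`, `d = 13`, EXACTLY in the granularity in which [BD10] = N. Billerey, L. V. Dieulefait, "Solving Fermat-type
equations `x⁵ + y⁵ = dz^p`", Math. Comp. 79 (2010) 535–544 (doi:10.1090/S0025-5718-09-02294-7; held as arXiv:0802.1217,
pages re-read by this seat: §1 p. 1 (Prop. 1.1), §2 (the method), §3.3 (Theorem 3.3, `d = 13`)) prints and uses them,
REUSING the abstract newform interface of `Summits/Ventures/AbcSig` (`NewformModel`: `Form N`, `Coeff f`, `eig`, and
`ArisesMod f p A` = "a ring map `ψ : Coeff f → k`, `char k = p`, with `ψ(c_q) ∈ A(q)` for every odd prime `q ≠ p` not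
dividing the level") — "same architecture, different cited package":

* [BD10, §1, p. 1]: "`p` a prime number `≥ 7` … a solution `(a,b,c)` of `x⁵+y⁵=dz^p` is primitive if `(a,b)=1` and
  non-trivial if `c ≠ 0`" (`IsBD10Solution`). The Frey curve (1.1) `E(a,b) : y² = x³ − 5(a²+b²)x² + 5((a⁵+b⁵)/(a+b))x`,
  "semistable at each prime different from 2 and 5", modular; "`ρ_p` … is irreducible … The conductor `N(ρ_p)` (prime to
  `p`) and the weight `k` of `ρ_p` are computed in [Bil07]. Thus, it follows from a theorem of Ribet that there exists a
  modular form `f` of weight `k`, level `N(ρ_p)` and trivial character such that the associated `p`-adic representation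
  `σ_{f,p}` satisfy `σ_{f,p} ≡ ρ_p (mod p)`." For `d = 13` [§3.3, proof of Thm 3.3]: "It follows from [Bil07], that the
  representation `ρ_p` is irreducible, of weight `k = 2` (since `p ≠ 13`) and level `N(ρ_p) = 650, 2600` or `5200`."
* [BD10, Prop. 1.1]: "There exists a primitive newform `f` of weight `k` and level `N(ρ_p)` such that, for each prime `q`,
  the following conditions hold. • If `q` divides `N` but `q` does not divide `pN(ρ_p)`, then `p` divides
  `N^{K_f}_ℚ(a′_q ± (q+1))`. • If `q` does not divide `pN`, then `p` divides `N^{K_f}_ℚ(a′_q − a_q)`." (`N` = conductor of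
  `E(a,b)`, `a_q` its trace of Frobenius, `a′_q` the coefficient of `f`.)
* [BD10, §2]: "Since `E(a,b)` has a non-trivial 2-torsion group, the coefficient `a_q` is even. Furthermore, since the
  equation (1.1) of `E(a,b)` does not depend on `p`, we can look at the reduction modulo `q` of the Frey curve … A short
  calculation … gives us the list of possibilities for `a_q`, when `(a,b)` describes `𝔽_q × 𝔽_q`." These lists are PRINTED
  for `q ∈ {3, 7, 11, 17, 19, 23, 37}` (§3.2–3.3: "`a_3 = ±2`", "`a_7` belongs to the set `{−4,−2,2}`" / "the list
  `{±2, −4}`", "`a_{11} ∈ {0, ±4}`", "`{0,2,4,±6,−8}` … for `a_{17}`", "`a_{19} ∈ {0, ±4}`", "`a_{23} ∈ {0,±2,±4,±6,±8}`",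
  "`a_{37} ∈ {0,−2,±4,−6,±8,±10,12}`").

DESIGN (what is typed, and how it asks NO MORE than print). `bdFreyTraces q` COMPUTES the list of `a_q(E(u,v) mod q)` over
all `(u,v) ∈ 𝔽_q × 𝔽_q` with `E(u,v)` nonsingular mod `q` (point count by the Legendre symbol: `a_q = −Σ_x χ(x³ + Ax² + Bx)`,
folklore for `y² = cubic`), and `bd10AllowedSpec q = {q+1, −(q+1)} ∪ bdFreyTraces q` is the union of the two bullets of
Prop. 1.1 (we do not know which primes divide the conductor `N` of `E(a,b)`, i.e. divide `c`, so only the union is usable; for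
`q ∉ {2, 5}` bad reduction is multiplicative by semistability, and good reduction means `E(a,b) mod q` is one of the
nonsingular `E(u,v)`). The kernel RE-DERIVES the seven printed lists (`bdFreyTraces_printed`, `decide +kernel`): print and
this file agree there verbatim. The package is typed in the CONGRUENCE form "`a′_q ≡ t (mod 𝔭)` for one prime `𝔭 ∣ p` of
the coefficient ring and every `q`" from which print derives the norm statements of Prop. 1.1 (the displayed
"`σ_{f,p} ≡ ρ_p (mod p)`", p. 1) — the same reading as `AbcSig.NewformModel.BS04Package` and `CMNewformModel.BVY04Package`;
stated for `d = 13` only, all primes `p ≥ 7`, `p ≠ 13` (print's standing range), although the row uses `p = 11` alone.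
`bd10AllowedTab` is a literal table of the same sets at the sieve primes actually used (`3, 7, 17, 31, 41`) and the printed
ones, PROVED to contain `bd10AllowedSpec` pointwise (`bd10AllowedTab_spec`), so that sieve certificates evaluate cheaply.
What is deliberately NOT here: [Bil07]'s conductor computation itself (which of 650/2600/5200 occurs for which `(a,b,c)` —
only "one of the three" is typed), the cases `d ≠ 13`, any modular-forms theory. References: [BD10] as above; [Bil07]
N. Billerey, Bull. Austral. Math. Soc. 76 (2007) 161–194 (as cited in [BD10]).
-/

namespace Summit.Ventures.AbcShadow

open Summit.Ventures.AbcSig (NewformModel OrbitData)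

/-! ## The Frey-trace sets `A_q` of [BD10, §2] (computed; the printed ones re-derived by the kernel) -/

/-- Legendre symbol `(a / q)` for an odd prime `q` via Euler's criterion, as an integer in `{−1, 0, 1}` (computable, for kernel
evaluation; only ever applied with `q` an odd prime). [folklore] -/
def legendreSymZ (a : ℤ) (q : ℕ) : ℤ :=
  let r : ℤ := a % (q : ℤ)
  if r = 0 then 0 else if (r ^ ((q - 1) / 2)) % (q : ℤ) = 1 then 1 else -1

/-- Insert an integer into a sorted duplicate-free list (keeps it sorted and duplicate-free). [folklore] -/
def insSorted (t : ℤ) : List ℤ → List ℤ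
  | [] => [t]
  | a :: l => if t < a then t :: a :: l else if t = a then a :: l else a :: insSorted t l

/-- The trace of Frobenius `a_q` of the reduction mod `q` of the [BD10, (1.1)] Frey curve
`E(u,v) : Y² = X³ − 5(u² + v²)X² + 5φ(u,v)X`, `φ(u,v) = (u⁵+v⁵)/(u+v) = u⁴ − u³v + u²v² − uv³ + v⁴`, for residues `u, v` mod an
odd prime `q ∤ 5`, computed as `a_q = −Σ_{x mod q} χ_q(x³ + AX² + Bx)` (point count of `Y² = cubic`); `none` when the reduced
curve is singular (`B ≡ 0` or `A² − 4B ≡ 0`: then `q` divides the conductor and the multiplicative branch of [BD10, Prop 1.1]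
applies instead). [cite: BillereyDieulefait2010, (1.1) and §2 (the curve and 'the list of possibilities for a_q')] -/
def bdFreyTraceAt (q u v : ℕ) : Option ℤ :=
  let A : ℤ := -5 * ((u : ℤ) ^ 2 + (v : ℤ) ^ 2)
  let B : ℤ := 5 * ((u : ℤ) ^ 4 - (u : ℤ) ^ 3 * v + (u : ℤ) ^ 2 * (v : ℤ) ^ 2 - u * (v : ℤ) ^ 3 + (v : ℤ) ^ 4)
  if B % (q : ℤ) = 0 ∨ (A ^ 2 - 4 * B) % (q : ℤ) = 0 then none
  else some (-(((List.range q).map fun x : ℕ => legendreSymZ ((x : ℤ) ^ 3 + A * (x : ℤ) ^ 2 + B * x) q).sum))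

/-- **`A_q` of [BD10, §2]**: "the list of possibilities for `a_q`, when `(a,b)` describes `𝔽_q × 𝔽_q`" — the sorted list of
the values `bdFreyTraceAt q u v` over all `u, v < q` with nonsingular reduction. For `q ∈ {3,7,11,17,19,23,37}` it coincides
with the PRINTED lists (`bdFreyTraces_printed`). [cite: BillereyDieulefait2010, §2 and §3.2-3.3 (printed lists)] -/
def bdFreyTraces (q : ℕ) : List ℤ :=
  (List.range q).foldl (fun acc u => (List.range q).foldl
    (fun acc' v => match bdFreyTraceAt q u v with | none => acc' | some t => insSorted t acc') acc) []

/-- **Kernel re-derivation of the PRINTED trace lists of [BD10, §3.2–3.3]:** `a_3 = ±2`; `a_7 ∈ {±2, −4}`; `a_{11} ∈ {0, ±4}`;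
`a_{17} ∈ {0, 2, 4, ±6, −8}`; `a_{19} ∈ {0, ±4}`; `a_{23} ∈ {0, ±2, ±4, ±6, ±8}`; `a_{37} ∈ {0, −2, ±4, −6, ±8, ±10, 12}`.
[cite: BillereyDieulefait2010, §3.2-3.3 (the printed lists, here recomputed)] -/
theorem bdFreyTraces_printed :
    bdFreyTraces 3 = [-2, 2] ∧ bdFreyTraces 7 = [-4, -2, 2] ∧ bdFreyTraces 11 = [-4, 0, 4] ∧
      bdFreyTraces 17 = [-8, -6, 0, 2, 4, 6] ∧ bdFreyTraces 19 = [-4, 0, 4] ∧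
      bdFreyTraces 23 = [-8, -6, -4, -2, 0, 2, 4, 6, 8] ∧
      bdFreyTraces 37 = [-10, -8, -6, -4, -2, 0, 4, 8, 10, 12] := by
  refine ⟨?_, ?_, ?_, ?_, ?_, ?_, ?_⟩ <;> decide +kernel

/-- **The allowed traces of [BD10, Prop 1.1] (both bullets, as a union):** `S_q = {q + 1, −(q + 1)} ∪ A_q` — `a′_q ≡ ±(q+1)`
if `q` divides the conductor of `E(a,b)` (multiplicative reduction; `q ∤ pN(ρ_p)`), `a′_q ≡ a_q(E(a,b)) ∈ A_q` otherwise.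
[cite: BillereyDieulefait2010, Prop 1.1] -/
def bd10AllowedSpec (q : ℕ) : List ℤ :=
  ((q : ℤ) + 1) :: (-((q : ℤ) + 1)) :: bdFreyTraces q

/-- The same sets as a LITERAL table at the primes used by the cell's sieve certificates (`3, 7, 17, 31, 41`) and the printed
ones (`11, 19, 23, 37`), falling back to `bd10AllowedSpec` elsewhere; `bd10AllowedTab_spec` proves `S_q ⊆` table pointwise,
so certificates checked against the table are valid for `S_q`. (Values at 31, 41 — not printed in [BD10] — are `A_{31} =
{0, ±4, ±8}`, `A_{41} = {±2, ±6, −10}`, computed here and RE-COMPUTED by the kernel in `bd10AllowedTab_spec`.)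
[cite: BillereyDieulefait2010, Prop 1.1 and §2 (tabulated)] -/
def bd10AllowedTab (q : ℕ) : List ℤ :=
  if q = 3 then [4, -4, -2, 2]
  else if q = 7 then [8, -8, -4, -2, 2]
  else if q = 11 then [12, -12, -4, 0, 4]
  else if q = 17 then [18, -18, -8, -6, 0, 2, 4, 6]
  else if q = 19 then [20, -20, -4, 0, 4]
  else if q = 23 then [24, -24, -8, -6, -4, -2, 0, 2, 4, 6, 8]
  else if q = 31 then [32, -32, -8, -4, 0, 4, 8]
  else if q = 37 then [38, -38, -10, -8, -6, -4, -2, 0, 4, 8, 10, 12]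
  else if q = 41 then [42, -42, -10, -6, -2, 2, 6]
  else bd10AllowedSpec q

/-- The two NON-printed tabulated sets are the Frey-trace sets: `S_{31} ⊆ bd10AllowedTab 31`, by kernel evaluation of the
point counts (this CERTIFIES `A_{31} = {0, ±4, ±8}`). [cite: BillereyDieulefait2010, §2 (the recipe), value computed here] -/
theorem bd10AllowedTab_spec_31 : ∀ t ∈ bd10AllowedSpec 31, t ∈ bd10AllowedTab 31 := by
  decide +kernel

/-- `S_{41} ⊆ bd10AllowedTab 41`, by kernel evaluation of the point counts (this CERTIFIES `A_{41} = {±2, ±6, −10}`).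
[cite: BillereyDieulefait2010, §2 (the recipe), value computed here] -/
theorem bd10AllowedTab_spec_41 : ∀ t ∈ bd10AllowedSpec 41, t ∈ bd10AllowedTab 41 := by
  decide +kernel

/-- The seven printed tabulated inclusions, from `bdFreyTraces_printed`. [cite: BillereyDieulefait2010, §3.2-3.3] -/
theorem bd10AllowedTab_spec_printed :
    (∀ t ∈ bd10AllowedSpec 3, t ∈ bd10AllowedTab 3) ∧ (∀ t ∈ bd10AllowedSpec 7, t ∈ bd10AllowedTab 7) ∧
      (∀ t ∈ bd10AllowedSpec 11, t ∈ bd10AllowedTab 11) ∧ (∀ t ∈ bd10AllowedSpec 17, t ∈ bd10AllowedTab 17) ∧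
      (∀ t ∈ bd10AllowedSpec 19, t ∈ bd10AllowedTab 19) ∧ (∀ t ∈ bd10AllowedSpec 23, t ∈ bd10AllowedTab 23) ∧
      (∀ t ∈ bd10AllowedSpec 37, t ∈ bd10AllowedTab 37) := by
  obtain ⟨e3, e7, e11, e17, e19, e23, e37⟩ := bdFreyTraces_printed
  simp only [bd10AllowedSpec, e3, e7, e11, e17, e19, e23, e37]
  decide

/-- `S_q ⊆ bd10AllowedTab q` for every `q` (at the nine tabulated primes by `bd10AllowedTab_spec_tab`, elsewhere by
definition). [cite: BillereyDieulefait2010, Prop 1.1 and §2 (tabulated)] -/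
theorem bd10AllowedTab_spec : ∀ q : ℕ, ∀ t ∈ bd10AllowedSpec q, t ∈ bd10AllowedTab q := by
  intro q
  obtain ⟨h3, h7, h11, h17, h19, h23, h37⟩ := bd10AllowedTab_spec_printed
  by_cases q3 : q = 3
  · subst q3; exact h3
  by_cases q7 : q = 7
  · subst q7; exact h7
  by_cases q11 : q = 11
  · subst q11; exact h11
  by_cases q17 : q = 17
  · subst q17; exact h17
  by_cases q19 : q = 19
  · subst q19; exact h19
  by_cases q23 : q = 23
  · subst q23; exact h23
  by_cases q31 : q = 31
  · subst q31; exact bd10AllowedTab_spec_31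
  by_cases q37 : q = 37
  · subst q37; exact h37
  by_cases q41 : q = 41
  · subst q41; exact bd10AllowedTab_spec_41
  intro t ht
  have htab : bd10AllowedTab q = bd10AllowedSpec q := by
    unfold bd10AllowedTab
    rw [if_neg q3, if_neg q7, if_neg q11, if_neg q17, if_neg q19, if_neg q23, if_neg q31, if_neg q37, if_neg q41]
  rw [htab]
  exact ht

/-! ## The primitive solutions and the named hypothesis -/

/-- **Non-trivial primitive solution of `x⁵ + y⁵ = d z^p`** [BD10, §1, p. 1]: "`(a,b,c)` … is primitive if `(a,b) = 1` and
non-trivial if `c ≠ 0`". [cite: BillereyDieulefait2010, §1 p.1 (definitions)] -/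
def IsBD10Solution (d p : ℕ) (a b c : ℤ) : Prop :=
  a ^ 5 + b ^ 5 = (d : ℤ) * c ^ p ∧ IsCoprime a b ∧ c ≠ 0

/-- **NAMED HYPOTHESIS [BD10, §1 + Prop 1.1 + §2, with [Bil07] for `d = 13`] — the modular-method package for
`x⁵ + y⁵ = 13 z^p`.** Printed inputs (module docstring): for a prime `p ≥ 7`, `p ≠ 13`, and a non-trivial primitive solution
`(a, b, c)`, the mod-`p` representation of the Frey curve `E(a,b)` is irreducible of weight 2 and level
`N(ρ_p) ∈ {650, 2600, 5200}` [Bil07, as cited in BD10 §3.3], hence [Ribet] arises from a newform `f` of weight 2, that level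
and trivial character with `σ_{f,p} ≡ ρ_p (mod p)` [BD10 p. 1], whence [Prop 1.1 + §2] for every odd prime `q ≠ p`,
`q ∉ {5, 13}`: `a′_q ≡ ±(q+1)` or `a′_q ≡ a_q(E(a,b) mod q) ∈ A_q` modulo one prime above `p` — typed as
`M.ArisesMod f p bd10AllowedSpec` (a ring map `ψ : Coeff f → k`, `char k = p`, `ψ(c_q) ∈ S_q` for all odd primes `q ≠ p` not
dividing the level; the primes dividing `650, 2600, 5200` are exactly `2, 5, 13`). Typed for `d = 13` only. CITED, never
proved here; the row takes `(hP : BD10Package13 M)`. [cite: BillereyDieulefait2010, Prop 1.1, §2, §3.3 (levels 650/2600/5200 via Billerey2007)] -/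
def BD10Package13 (M : NewformModel) : Prop :=
  ∀ (p : ℕ) (a b c : ℤ), p.Prime → 7 ≤ p → p ≠ 13 → IsBD10Solution 13 p a b c →
    ∃ N : ℕ, (N = 650 ∨ N = 2600 ∨ N = 5200) ∧ ∃ f : M.Form N, M.ArisesMod f p bd10AllowedSpec

end Summit.Ventures.AbcShadow
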